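import Summits.BirchSwinnertonDyer.BirchSwinnertonDyer.Theorems.SylvesterTwoHeegnerIndexCoupledDescentL1FamilyVacuity
import Summits.BirchSwinnertonDyer.BirchSwinnertonDyer.Theorems.SylvesterTwoHeegnerIndexLowerHalfTwoRankFourMembers
import HarnessLib

/-!
# VACUITY of VARIANT L's leaf stubs at the CERTIFIED members `E_{1054327}` (`p ≡ 4 (9)`) and
# `E_{562399}` (`p ≡ 7 (9)`) — in the certificate currency of `…LowerHalfTwoRankFourMembers`

Crux `UpperOffV0HSYPlus` (stmt-BirchSwinnertonDyer-19804); VARIANT L (`Lines/coupled_variantL.lean`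
c745230b5cc31032, D439, reverted D440).  `not_L1Four_of_facts_of_cert_1054327` /
`not_L1Seven_of_facts_of_cert_562399`: granted `PublishedFactsTwoPlus`, minimal models `A, B` of
`E_{3p²}, E_p`, and the DISPLAYED `2`-descent certificate `hT` of
`SylvesterTwoLowerCert.bsdTwo_member_of_twoRankFour_cert` VERBATIM — `#Ш(W)[2] = 16` and
`Ш(W)[4] = Ш(W)[2]` for every minimal model `W` of `E_p` (PARI `ellrank = [1,1,4]` at efforts 0/1/2 on
the `bnfcertify`'d cubic field `ℚ(∛4p)`, GRH-free; kit j269192 / j269295; referee G63 countersign) —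
VARIANT L's leaf stub `stub_L1Four` (resp. `stub_L1Seven`) is FALSE: by
`natCard_sha_eq_one_pair_of_L1Four/Seven` it would force `#Ш(B)[2^∞] = 1`, whereas the certificate
gives `#Ш(B)[2^∞] = #Ш(B)[2] = 16`.  (Only the first half of `hT` and `Ш[4] = Ш[2]` are used; the
analytic certificate `#Ш_an = 16` is NOT used.)  HONEST LABEL: refutation MODULO a displayed
certificate — an implication, exactly the currency of the LOWER-half member files; nothing is refuted
on the ledger (VARIANT L's stubs are workfile stubs, not items).  Theorem-only; nothing asserted on
19804; no label moves; BSD not claimed for any curve.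
-/

set_option linter.dupNamespace false -- Summits modules are `Summit.<Summit>.<Problem>…` by design

noncomputable section

open scoped Classical
open WeierstrassCurve WeierstrassCurve.Affine WeierstrassCurve.Affine.Point NumberField IsDedekindDomain
open Field Literature.NumberTheory.EllipticCurves Literature.NumberTheory.GaloisRepresentations
open Literature.NumberTheory.EllipticCurves.HuShuYin2019
open Summit.BirchSwinnertonDyer.BirchSwinnertonDyer.Theses.SylvesterTwoHeegnerIndex
  hiding HSYPointTwoDivisibleSevenModNine

namespace Summit.BirchSwinnertonDyer.BirchSwinnertonDyer.Theorems.SylvesterTwoCoupledDescentCebotarev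

open SylvesterTwoLowerCert

/-- **`stub_L1Four` is FALSE granted `PublishedFactsTwoPlus` and the displayed `2`-descent certificate
at `p = 1054327`** (`p ≡ 4 (9)`, `3 ∉ 𝔽_p^{×3}` — `SylvesterTwoLowerCert.hsy_1054327`): `Ш(E_{1054327})[2] ≅ (ℤ/2)⁴` with `Ш[4] = Ш[2]` (PARI `ellrank = [1,1,4]` ×3 on the `bnfcertify`'d field `ℚ(∛(4·1054327))`, `Cl ≅ [6,2,2,2]`, kit j269295; `#Ш_an = 16` j269511 / j283102 not used here).
`hT` is `SylvesterTwoLowerCert.bsdTwo_member_of_twoRankFour_cert`'s certificate VERBATIM (a HYPOTHESIS,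
not a kernel fact); `A, B` are any minimal models of `E_{3p²}, E_p`.  HONEST LABEL: implication
modulo the displayed certificate; nothing refuted on the ledger. [cite: HuShuYin2019, Thm. 1.3 and
Thm. 1.4 (p. 3)] -/
theorem not_L1Four_of_facts_of_cert_1054327 (hF : PublishedFactsTwoPlus) (A B : WeierstrassCurve ℚ)
    [A.IsElliptic] [A.IsGloballyMinimal] [B.IsElliptic] [B.IsGloballyMinimal]
    (hB : ∃ C : VariableChange ℚ, C • B = HuShuYin2019.cubeSumCurve ((1054327 : ℕ) : ℚ))
    (hA : ∃ C : VariableChange ℚ, C • A = HuShuYin2019.cubeSumCurve (3 * ((1054327 : ℕ) : ℚ) ^ 2))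
    (hT : ∀ (W : WeierstrassCurve ℚ) [W.IsElliptic] [W.IsGloballyMinimal],
      (∃ C : VariableChange ℚ, C • W = cubeSumCurve ((1054327 : ℕ) : ℚ)) →
        Nat.card (AddSubgroup.torsionBy W.sha (2 : ℕ)) = 16 ∧
        ∀ z : W.sha, (2 * 2) • z = 0 → 2 • z = 0) :
    ¬ (∀ (p : ℕ), p.Prime → p % 9 = 4 → (¬ ∃ x : ZMod p, x ^ 3 = 3) →
            ∀ (K : Type) [Field K] [NumberField K] (ω : K), ω ^ 2 + ω + 1 = 0 →
              Module.finrank ℚ K = 2 →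
            ∀ Y₀ : ((cubeSumCurve (p : ℚ)).baseChange K).toAffine.Point,
              (¬ ∃ Q : ((cubeSumCurve (p : ℚ)).baseChange K).toAffine.Point, (2 : ℕ) • Q = Y₀) →
            ∃ (cA : ℕ → galH1Torsion ((cubeSumCurve (3 * (p : ℚ) ^ 2)).baseChange K) (2 : ℕ))
              (cB : ℕ → galH1Torsion ((cubeSumCurve (p : ℚ)).baseChange K) (2 : ℕ)),
            (∀ ℓ, (ℓ.Prime ∧ ¬ ℓ ∣ (cubeSumCurve (3 * (p : ℚ) ^ 2)).conductorNorm ℤ ∧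
                ¬ ℓ ∣ (cubeSumCurve (p : ℚ)).conductorNorm ℤ ∧ ¬ ((ℓ : ℤ) ∣ NumberField.discr K) ∧ ℓ ≠ 2 ∧
                (Ideal.span {(ℓ : 𝓞 K)}).IsPrime ∧
                FrobEqFrobInfty (cubeSumCurve (3 * (p : ℚ) ^ 2)) K 2 ℓ ∧
                FrobEqFrobInfty (cubeSumCurve (p : ℚ)) K 2 ℓ) →
              (∀ v : HeightOneSpectrum (𝓞 K), (ℓ : 𝓞 K) ∉ v.asIdeal →
                cA ℓ ∈ selmerLocalKer ((cubeSumCurve (3 * (p : ℚ) ^ 2)).baseChange K)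
                  (v.adicCompletion K) (2 : ℕ)) ∧
              (∀ x : InfinitePlace K, cA ℓ ∈ selmerLocalKer
                ((cubeSumCurve (3 * (p : ℚ) ^ 2)).baseChange K) x.Completion (2 : ℕ)) ∧
              (∀ v : HeightOneSpectrum (𝓞 K), (ℓ : 𝓞 K) ∈ v.asIdeal →
                (cA ℓ ∈ selmerLocalKer ((cubeSumCurve (3 * (p : ℚ) ^ 2)).baseChange K)
                    (v.adicCompletion K) (2 : ℕ) ↔
                  kummerClassOfPoint (cubeSumCurve (p : ℚ)) K Nat.prime_two Y₀ ∈
                    ((cubeSumCurve (p : ℚ)).baseChange K).torsionLocalKer (v.adicCompletion K) (2 : ℕ)))) ∧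
            (∀ ℓ ℓ', (ℓ.Prime ∧ ¬ ℓ ∣ (cubeSumCurve (3 * (p : ℚ) ^ 2)).conductorNorm ℤ ∧
                ¬ ℓ ∣ (cubeSumCurve (p : ℚ)).conductorNorm ℤ ∧ ¬ ((ℓ : ℤ) ∣ NumberField.discr K) ∧ ℓ ≠ 2 ∧
                (Ideal.span {(ℓ : 𝓞 K)}).IsPrime ∧
                FrobEqFrobInfty (cubeSumCurve (3 * (p : ℚ) ^ 2)) K 2 ℓ ∧
                FrobEqFrobInfty (cubeSumCurve (p : ℚ)) K 2 ℓ) →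
              (ℓ'.Prime ∧ ¬ ℓ' ∣ (cubeSumCurve (3 * (p : ℚ) ^ 2)).conductorNorm ℤ ∧
                ¬ ℓ' ∣ (cubeSumCurve (p : ℚ)).conductorNorm ℤ ∧ ¬ ((ℓ' : ℤ) ∣ NumberField.discr K) ∧
                ℓ' ≠ 2 ∧ (Ideal.span {(ℓ' : 𝓞 K)}).IsPrime ∧
                FrobEqFrobInfty (cubeSumCurve (3 * (p : ℚ) ^ 2)) K 2 ℓ' ∧
                FrobEqFrobInfty (cubeSumCurve (p : ℚ)) K 2 ℓ') → ℓ ≠ ℓ' →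
              (∀ v : HeightOneSpectrum (𝓞 K), (ℓ : 𝓞 K) ∉ v.asIdeal → (ℓ' : 𝓞 K) ∉ v.asIdeal →
                cB (ℓ * ℓ') ∈ selmerLocalKer ((cubeSumCurve (p : ℚ)).baseChange K)
                  (v.adicCompletion K) (2 : ℕ)) ∧
              (∀ x : InfinitePlace K,
                cB (ℓ * ℓ') ∈ selmerLocalKer ((cubeSumCurve (p : ℚ)).baseChange K) x.Completion (2 : ℕ)) ∧
              (∀ v : HeightOneSpectrum (𝓞 K), (ℓ : 𝓞 K) ∈ v.asIdeal →
                (cB (ℓ * ℓ') ∈ selmerLocalKer ((cubeSumCurve (p : ℚ)).baseChange K)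
                    (v.adicCompletion K) (2 : ℕ) ↔
                  cA ℓ' ∈ ((cubeSumCurve (3 * (p : ℚ) ^ 2)).baseChange K).torsionLocalKer
                    (v.adicCompletion K) (2 : ℕ))))) := by
  haveI : Fact (Nat.Prime 2) := ⟨Nat.prime_two⟩
  obtain ⟨h16, h42⟩ := hT B hB
  have hprim : Nat.card (AddCommGroup.primaryComponent B.sha 2) = 16 := by
    rw [natCard_primaryComponent_eq_of_sq h42, h16]
  exact not_L1Four_of_facts_of_sha_ne_one hF hsy_1054327.1 (by norm_num) hsy_1054327.2.2 A B hB hA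
    (Or.inl (by rw [hprim]; norm_num))

/-- **`stub_L1Seven` is FALSE granted `PublishedFactsTwoPlus` and the displayed `2`-descent certificate
at `p = 562399`** (`p ≡ 7 (9)`, `3 ∉ 𝔽_p^{×3}` — `SylvesterTwoLowerCert.hsy_562399`): `Ш(E_{562399})[2] ≅ (ℤ/2)⁴` with `Ш[4] = Ш[2]` (PARI `ellrank = [1,1,4]` ×3 on the `bnfcertify`'d field `ℚ(∛(4·562399))`, `Cl ≅ [12,2,2]`, kit j269295; `#Ш_an = 16` j269511 not used here).
`hT` is `SylvesterTwoLowerCert.bsdTwo_member_of_twoRankFour_cert`'s certificate VERBATIM (a HYPOTHESIS,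
not a kernel fact); `A, B` are any minimal models of `E_{3p²}, E_p`.  HONEST LABEL: implication
modulo the displayed certificate; nothing refuted on the ledger. [cite: HuShuYin2019, Thm. 1.3 and
Thm. 1.4 (p. 3)] -/
theorem not_L1Seven_of_facts_of_cert_562399 (hF : PublishedFactsTwoPlus) (A B : WeierstrassCurve ℚ)
    [A.IsElliptic] [A.IsGloballyMinimal] [B.IsElliptic] [B.IsGloballyMinimal]
    (hB : ∃ C : VariableChange ℚ, C • B = HuShuYin2019.cubeSumCurve ((562399 : ℕ) : ℚ))
    (hA : ∃ C : VariableChange ℚ, C • A = HuShuYin2019.cubeSumCurve (3 * ((562399 : ℕ) : ℚ) ^ 2))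
    (hT : ∀ (W : WeierstrassCurve ℚ) [W.IsElliptic] [W.IsGloballyMinimal],
      (∃ C : VariableChange ℚ, C • W = cubeSumCurve ((562399 : ℕ) : ℚ)) →
        Nat.card (AddSubgroup.torsionBy W.sha (2 : ℕ)) = 16 ∧
        ∀ z : W.sha, (2 * 2) • z = 0 → 2 • z = 0) :
    ¬ (∀ (p : ℕ), p.Prime → p % 9 = 7 → (¬ ∃ x : ZMod p, x ^ 3 = 3) →
            ∀ (K : Type) [Field K] [NumberField K] (ω : K), ω ^ 2 + ω + 1 = 0 →
              Module.finrank ℚ K = 2 →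
            ∀ Y₀ : ((cubeSumCurve (p : ℚ)).baseChange K).toAffine.Point,
              (¬ ∃ Q : ((cubeSumCurve (p : ℚ)).baseChange K).toAffine.Point, (2 : ℕ) • Q = Y₀) →
            ∃ (cA : ℕ → galH1Torsion ((cubeSumCurve (3 * (p : ℚ) ^ 2)).baseChange K) (2 : ℕ))
              (cB : ℕ → galH1Torsion ((cubeSumCurve (p : ℚ)).baseChange K) (2 : ℕ)),
            (∀ ℓ, (ℓ.Prime ∧ ¬ ℓ ∣ (cubeSumCurve (3 * (p : ℚ) ^ 2)).conductorNorm ℤ ∧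
                ¬ ℓ ∣ (cubeSumCurve (p : ℚ)).conductorNorm ℤ ∧ ¬ ((ℓ : ℤ) ∣ NumberField.discr K) ∧ ℓ ≠ 2 ∧
                (Ideal.span {(ℓ : 𝓞 K)}).IsPrime ∧
                FrobEqFrobInfty (cubeSumCurve (3 * (p : ℚ) ^ 2)) K 2 ℓ ∧
                FrobEqFrobInfty (cubeSumCurve (p : ℚ)) K 2 ℓ) →
              (∀ v : HeightOneSpectrum (𝓞 K), (ℓ : 𝓞 K) ∉ v.asIdeal →
                cA ℓ ∈ selmerLocalKer ((cubeSumCurve (3 * (p : ℚ) ^ 2)).baseChange K)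
                  (v.adicCompletion K) (2 : ℕ)) ∧
              (∀ x : InfinitePlace K, cA ℓ ∈ selmerLocalKer
                ((cubeSumCurve (3 * (p : ℚ) ^ 2)).baseChange K) x.Completion (2 : ℕ)) ∧
              (∀ v : HeightOneSpectrum (𝓞 K), (ℓ : 𝓞 K) ∈ v.asIdeal →
                (cA ℓ ∈ selmerLocalKer ((cubeSumCurve (3 * (p : ℚ) ^ 2)).baseChange K)
                    (v.adicCompletion K) (2 : ℕ) ↔
                  kummerClassOfPoint (cubeSumCurve (p : ℚ)) K Nat.prime_two Y₀ ∈
                    ((cubeSumCurve (p : ℚ)).baseChange K).torsionLocalKer (v.adicCompletion K) (2 : ℕ)))) ∧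
            (∀ ℓ ℓ', (ℓ.Prime ∧ ¬ ℓ ∣ (cubeSumCurve (3 * (p : ℚ) ^ 2)).conductorNorm ℤ ∧
                ¬ ℓ ∣ (cubeSumCurve (p : ℚ)).conductorNorm ℤ ∧ ¬ ((ℓ : ℤ) ∣ NumberField.discr K) ∧ ℓ ≠ 2 ∧
                (Ideal.span {(ℓ : 𝓞 K)}).IsPrime ∧
                FrobEqFrobInfty (cubeSumCurve (3 * (p : ℚ) ^ 2)) K 2 ℓ ∧
                FrobEqFrobInfty (cubeSumCurve (p : ℚ)) K 2 ℓ) →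
              (ℓ'.Prime ∧ ¬ ℓ' ∣ (cubeSumCurve (3 * (p : ℚ) ^ 2)).conductorNorm ℤ ∧
                ¬ ℓ' ∣ (cubeSumCurve (p : ℚ)).conductorNorm ℤ ∧ ¬ ((ℓ' : ℤ) ∣ NumberField.discr K) ∧
                ℓ' ≠ 2 ∧ (Ideal.span {(ℓ' : 𝓞 K)}).IsPrime ∧
                FrobEqFrobInfty (cubeSumCurve (3 * (p : ℚ) ^ 2)) K 2 ℓ' ∧
                FrobEqFrobInfty (cubeSumCurve (p : ℚ)) K 2 ℓ') → ℓ ≠ ℓ' →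
              (∀ v : HeightOneSpectrum (𝓞 K), (ℓ : 𝓞 K) ∉ v.asIdeal → (ℓ' : 𝓞 K) ∉ v.asIdeal →
                cB (ℓ * ℓ') ∈ selmerLocalKer ((cubeSumCurve (p : ℚ)).baseChange K)
                  (v.adicCompletion K) (2 : ℕ)) ∧
              (∀ x : InfinitePlace K,
                cB (ℓ * ℓ') ∈ selmerLocalKer ((cubeSumCurve (p : ℚ)).baseChange K) x.Completion (2 : ℕ)) ∧
              (∀ v : HeightOneSpectrum (𝓞 K), (ℓ : 𝓞 K) ∈ v.asIdeal →
                (cB (ℓ * ℓ') ∈ selmerLocalKer ((cubeSumCurve (p : ℚ)).baseChange K)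
                    (v.adicCompletion K) (2 : ℕ) ↔
                  cA ℓ' ∈ ((cubeSumCurve (3 * (p : ℚ) ^ 2)).baseChange K).torsionLocalKer
                    (v.adicCompletion K) (2 : ℕ))))) := by
  haveI : Fact (Nat.Prime 2) := ⟨Nat.prime_two⟩
  obtain ⟨h16, h42⟩ := hT B hB
  have hprim : Nat.card (AddCommGroup.primaryComponent B.sha 2) = 16 := by
    rw [natCard_primaryComponent_eq_of_sq h42, h16]
  exact not_L1Seven_of_facts_of_sha_ne_one hF hsy_562399.1 (by norm_num) hsy_562399.2.2 A B hB hA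
    (Or.inl (by rw [hprim]; norm_num))

end Summit.BirchSwinnertonDyer.BirchSwinnertonDyer.Theorems.SylvesterTwoCoupledDescentCebotarev

end
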